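import Literature.Topology.FourManifolds.OneHandleStep
import HarnessLib

/-!
# The handle-extension step for one `1`-handle: the handle pair and the diffeomorphism

Topic `Literature/Topology/FourManifolds` (fact seat
`provefact-Literature.Topology.FourManifolds.IsHandlebody.exists_diffeomorph_isBoundaryGluing_sphere`,
step F2b₁ of the Lickorish–Wallace DAG; assembly of the level step H of the reduction of L1
`oneHandle_nonempty_diffeomorph`, concluded from `OneHandleStep.lean`).  Everything here is
**proved**; no named facts.

From the extended pair of `OneHandleStep.lean` (a lower pair `(g, g')` at the level
`A = a + 2η₀`, width `η₀ ∈ (η/2, 2η/3]`, equal to the chart correspondence on the feet at the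
level `a`) this file builds the **lower correspondence** `low` of the tree's
`Literature.Topology.FourManifolds.LowerData` (`FlowExtension.lean`, reference level `A - 2η₀ = a`),
checks the axioms of a `Literature.Topology.FourManifolds.HandlePair` (`HandleConjugation.lean`)
— in particular **agreement with the chart map on the feet tubes** (`low_eq_chartMap`: a point
of the handle region near the level `a` flows inside the region to a foot point of the closed
unit parameter ball, `HandleChart.exists_eq_foot`, where `g` is the chart map; the chart map
commutes with the flows, `IsFlowOf.chartMap_apply_eq`; hence `low = chartMap` by
`LowerData.low_eq_of`) — and applies the tree's handle-extension theorem
`HandlePair.exists_diffeomorph_apply_eq` (`HandleStepAssembly.lean`): **`M ≅ M'`**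
(`OneHandleStepContext.nonempty_diffeomorph`).

## References

* J. Milnor, *Lectures on the h-cobordism theorem* (1965), proof of Thm. 3.13 (PDF pp. 18–19).
  [MilnorHCobordism1965]
-/

open scoped Manifold ContDiff Topology
open Set Function Filter Metric Module

noncomputable section

namespace Literature.Topology.FourManifolds

universe u

/-- Local notation: `𝔼 n` is the model Euclidean space `EuclideanSpace ℝ (Fin n)`. -/
local notation "𝔼 " n:arg => EuclideanSpace ℝ (Fin n)

namespace OneHandleStepContext

variable {n : ℕ} {M : Type u} [TopologicalSpace M] [ChartedSpace (EuclideanHalfSpace (n + 1)) M]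
  [IsManifold (𝓡∂ (n + 1)) ∞ M] [T2Space M]
  {M' : Type u} [TopologicalSpace M'] [ChartedSpace (EuclideanHalfSpace (n + 1)) M'] [IsManifold (𝓡∂ (n + 1)) ∞ M']
  [T2Space M'] (C : OneHandleStepContext n M M')
  {g : M → M'} {g' : M' → M} {η₀ : ℝ} {N : ℕ}
  (hη₀ : C.S.η / 2 < η₀) (hη₀' : η₀ ≤ 2 * C.S.η / 3) (hA : C.c + C.τ + N * η₀ = C.S.a + 2 * η₀)
  (hP : IsLowerPair C.Sl C.Sl' C.σ (C.c + C.τ + N * η₀) η₀ g g')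

/-! ### The lower data of the extended pair -/

omit [T2Space M] [T2Space M'] in
include hη₀' hA in
/-- Band condition below. [folklore] -/
theorem pair_hlo : C.Sl.lo ≤ C.c + C.τ + N * η₀ - 6 * η₀ := by
  show C.S.ℓ₁ ≤ _; rw [hA, C.hℓ₁_eq]
  have := C.c_le; have := C.hηε; have := C.hητ; have := C.η_pos; have := C.τ_pos
  linarith [sq_nonneg C.S.ε]

omit [T2Space M] [T2Space M'] in
include hη₀' hA in
/-- Band condition above. [folklore] -/
theorem pair_hhi : C.c + C.τ + N * η₀ + η₀ ≤ C.Sl.hi := by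
  show _ ≤ C.S.a + 2 * C.S.η; rw [hA]; linarith

omit [T2Space M] [T2Space M'] in
include hη₀' hA in
/-- Band condition below (`M'`). [folklore] -/
theorem pair_hlo' : C.Sl'.lo ≤ C.c + C.τ + N * η₀ + C.σ - 6 * η₀ := by
  show C.S'.ℓ₁ ≤ _; rw [C.hℓ₁, C.hℓ₁_eq]
  have := C.c_le; have := C.hηε; have := C.hητ; have := C.η_pos; have := C.τ_pos
  linarith [sq_nonneg C.S.ε, hA]

omit [T2Space M] [T2Space M'] in
include hη₀' hA in
/-- Band condition above (`M'`). [folklore] -/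
theorem pair_hhi' : C.c + C.τ + N * η₀ + C.σ + η₀ ≤ C.Sl'.hi := by
  show _ ≤ C.S'.a + 2 * C.S'.η; rw [C.ha, C.hη]; linarith

omit [T2Space M] [T2Space M'] in
include hη₀ in
/-- `0 < η₀`. [folklore] -/
theorem η₀_pos : 0 < η₀ := by linarith [C.η_pos]

/-- **The lower data of the extended pair** (reference level `A - 2η₀ = a`).
[cite: MilnorHCobordism1965, proof of Thm. 3.13 (PDF pp. 18–19)] -/
def Ld : LowerData (n := n) M M' :=
  hP.lowerData (C.η₀_pos hη₀) (C.pair_hlo hη₀' hA) (C.pair_hhi hη₀' hA) (C.pair_hlo' hη₀' hA) (C.pair_hhi' hη₀' hA)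

/-! ### Agreement with the chart map on the feet -/

variable (hfeet : ∀ {s : ℝ} (hs : s ^ 2 = 1) (w : 𝔼 n), ‖w‖ ≤ 1 → (s = 1 ∨ s = -1) →
  g (C.S.D.foot s C.m C.ρ w) = C.S'.D.foot s C.m' C.ρ w)

omit [T2Space M] [T2Space M'] in
/-- `2γ ≤ m ρ²` (the closed unit parameter balls of the feet cover the region's slice). [folklore] -/
theorem two_γ_le : 2 * C.S.γ ≤ C.m * C.ρ ^ 2 := by
  rw [C.hγ_eq, C.hr_eq, C.m_eq, OneHandleStepContext.ρ]; nlinarith [C.ε_pos, sq_nonneg C.S.ε, pow_pos C.ε_pos 4]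

omit [T2Space M] [T2Space M'] in
/-- `2γ' ≤ m' ρ²`. [folklore] -/
theorem two_γ_le' : 2 * C.S'.γ ≤ C.m' * C.ρ ^ 2 := by
  rw [C.hγ, C.m'_eq, C.hγ_eq, C.hr_eq, OneHandleStepContext.ρ]; nlinarith [C.ε_pos, sq_nonneg C.S.ε, pow_pos C.ε_pos 4]

omit [T2Space M] [T2Space M'] in
/-- **A point of the region near the level `a` flows inside the region to a foot of the closed
unit parameter ball.** [cite: MilnorHCobordism1965, proof of Thm. 3.13 (PDF p. 18)] -/
theorem exists_foot_of_mem_region {y : M} (hy : y ∈ C.S.N) (hfy : C.S.f y ∈ Ioo (C.S.a - C.S.η / 2) (C.S.a + C.S.η / 2)) :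
    C.S.θ (C.S.a - C.S.f y, y) ∈ C.S.N ∧ C.S.f (C.S.θ (C.S.a - C.S.f y, y)) = C.S.a ∧
      ∃ s : ℝ, (s = 1 ∨ s = -1) ∧ ∃ w : 𝔼 n, ‖w‖ ≤ 1 ∧ C.S.θ (C.S.a - C.S.f y, y) = C.S.D.foot s C.m C.ρ w := by
  have hη := C.η_pos
  have hya : C.S.a - C.S.η / 4 ≤ C.S.f y := hy.2.2.2.2.1
  have hys : C.S.f y ∈ Ioo C.Sl.lo C.Sl.hi := ⟨by show C.S.ℓ₁ < _; linarith [C.ℓ₁_lt, C.c_le, C.τ_pos, sq_nonneg C.S.ε, C.hηε, C.η_pos], by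
    show _ < C.S.a + 2 * C.S.η; linarith [hfy.2]⟩
  -- the clock along the segment
  have hclock : ∀ t, C.S.f y + t ∈ Icc (C.S.a - C.S.η / 4) (C.S.a + C.S.η / 2) → C.S.f (C.S.θ (t, y)) = C.S.f y + t := fun t ht =>
    C.Sl.apply_flow hys ⟨by show C.S.ℓ₁ < _; linarith [C.ℓ₁_lt, C.c_le, C.τ_pos, sq_nonneg C.S.ε, ht.1, C.hηε, C.η_pos], by
      show _ < C.S.a + 2 * C.S.η; linarith [ht.2]⟩
  have hva : C.S.f (C.S.θ (C.S.a - C.S.f y, y)) = C.S.a := by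
    rw [hclock _ ⟨by linarith, by linarith⟩]; ring
  -- the segment stays in the region
  have hlev : ∀ t ∈ Icc (min 0 (C.S.a - C.S.f y)) (max 0 (C.S.a - C.S.f y)),
      C.S.f (C.S.θ (t, y)) ∈ Icc (C.S.a - C.S.η / 4) C.S.ℓu := by
    intro t ht
    have ht' : C.S.f y + t ∈ Icc (C.S.a - C.S.η / 4) (C.S.a + C.S.η / 2) := by
      rcases le_total 0 (C.S.a - C.S.f y) with h0 | h0
      · rw [min_eq_left h0, max_eq_right h0] at ht; exact ⟨by linarith [ht.1], by linarith [ht.2]⟩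
      · rw [min_eq_right h0, max_eq_left h0] at ht; exact ⟨by linarith [ht.1], by linarith [ht.2, hfy.2]⟩
    rw [hclock t ht']
    exact ⟨ht'.1, by linarith [ht'.2, C.S.a_lt_ℓu, C.S.ha, C.S.δ_pos]⟩
  have hvN : C.S.θ (C.S.a - C.S.f y, y) ∈ C.S.N := by
    have hiff := C.S.mem_N_iff hlev (t := C.S.a - C.S.f y) (t' := 0) ⟨min_le_right _ _, le_max_right _ _⟩
      ⟨min_le_left _ _, le_max_left _ _⟩
    rw [C.S.isFlowOf.map_zero] at hiff
    exact hiff.2 hy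
  refine ⟨hvN, hva, ?_⟩
  -- a foot of the closed unit ball
  obtain ⟨s, hs1, w, hw, hv⟩ := C.S.D.exists_eq_foot (s := 1) (one_pow 2) C.T.hm C.ρ_pos C.hk C.two_γ_le hvN.1
    (by rw [hva, C.fp_sub_m]) (by have := hvN.2.2.2.1; rw [C.hk] at this; exact this)
    (show ‖C.S.D.coord (C.S.θ (C.S.a - C.S.f y, y))‖ < 3 * C.S.ε from (C.S.N_subset_cball hvN).2)
  exact ⟨s, hs1, w, hw, hv⟩

omit [T2Space M] in
/-- **The chart map commutes with the flows on the region**: `chartMap y = θ' (f y - a, chartMap v)`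
for the foot point `v = θ (a - f y, y)`. [cite: LeeSmoothManifolds2013, Prop. 9.13] -/
theorem chartMap_eq_flow {y : M} (hy : y ∈ C.S.N) (hfy : C.S.f y ∈ Ioo (C.S.a - C.S.η / 2) (C.S.a + C.S.η / 2)) :
    C.S.D.chartMap C.S'.D y = C.S'.θ (C.S.f y - C.S.a, C.S.D.chartMap C.S'.D (C.S.θ (C.S.a - C.S.f y, y))) := by
  obtain ⟨hvN, hva, -⟩ := C.exists_foot_of_mem_region hy hfy
  have hη := C.η_pos
  set v := C.S.θ (C.S.a - C.S.f y, y) with hv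
  have hvs : C.S.f v ∈ Ioo C.Sl.lo C.Sl.hi := by
    rw [hva]; exact ⟨by show C.S.ℓ₁ < _; linarith [C.ℓ₁_lt, C.c_le, C.τ_pos, sq_nonneg C.S.ε, C.hηε, C.η_pos], by show _ < C.S.a + 2 * C.S.η; linarith⟩
  have hclock : ∀ t, C.S.a + t ∈ Icc (C.S.a - C.S.η / 4) (C.S.a + C.S.η / 2) → C.S.f (C.S.θ (t, v)) = C.S.a + t := fun t ht => by
    rw [← hva]; exact C.Sl.apply_flow hvs ⟨by show C.S.ℓ₁ < C.S.f v + t; rw [hva]; linarith [C.ℓ₁_lt, C.c_le, C.τ_pos, sq_nonneg C.S.ε, ht.1, C.hηε, C.η_pos], by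
      show C.S.f v + t < C.S.a + 2 * C.S.η; rw [hva]; linarith [ht.2]⟩
  have hya : C.S.a - C.S.η / 4 ≤ C.S.f y := hy.2.2.2.2.1
  have hmem : ∀ t ∈ Icc (min 0 (C.S.f y - C.S.a)) (max 0 (C.S.f y - C.S.a)), C.S.θ (t, v) ∈ C.S.D.cball (3 * C.S.ε) := by
    intro t ht
    apply C.S.N_subset_cball
    have hlev : ∀ t' ∈ Icc (min 0 (C.S.f y - C.S.a)) (max 0 (C.S.f y - C.S.a)),
        C.S.f (C.S.θ (t', v)) ∈ Icc (C.S.a - C.S.η / 4) C.S.ℓu := by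
      intro t' ht'
      have ht'' : C.S.a + t' ∈ Icc (C.S.a - C.S.η / 4) (C.S.a + C.S.η / 2) := by
        rcases le_total 0 (C.S.f y - C.S.a) with h0 | h0
        · rw [min_eq_left h0, max_eq_right h0] at ht'; exact ⟨by linarith [ht'.1], by linarith [ht'.2, hfy.2]⟩
        · rw [min_eq_right h0, max_eq_left h0] at ht'; exact ⟨by linarith [ht'.1], by linarith [ht'.2]⟩
      rw [hclock t' ht'']
      exact ⟨ht''.1, by linarith [ht''.2, C.S.a_lt_ℓu, C.S.ha, C.S.δ_pos]⟩
    have hiff := C.S.mem_N_iff hlev (t := t) (t' := 0) ht ⟨min_le_left _ _, le_max_left _ _⟩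
    rw [C.S.isFlowOf.map_zero] at hiff
    exact hiff.2 hvN
  have h1inf : (1 : ℕ∞ω) ≤ ∞ := by exact_mod_cast le_top
  have h := IsFlowOf.chartMap_apply_eq C.S.isFlowOf C.S'.isFlowOf (C.S'.hX.of_le h1inf) C.S.D C.S'.D
    (R := 3 * C.S.ε) (by rw [← C.hε]; exact C.S'.hball) (by rw [C.hk, C.hk']) C.hr.symm
    (min_le_left _ _) (le_max_left _ _) hmem ⟨min_le_right _ _, le_max_right _ _⟩
  rw [C.S.isFlowOf.map_add, show C.S.f y - C.S.a + (C.S.a - C.S.f y) = 0 by ring, C.S.isFlowOf.map_zero] at h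
  exact h

include hfeet in
omit [T2Space M] in
/-- **The lower correspondence is the chart map on the feet tubes.**
[cite: MilnorHCobordism1965, proof of Thm. 3.13 (PDF pp. 18–19)] -/
theorem low_eq_chartMap {y : M} (hy : y ∈ C.S.D.region C.S.ε C.S.γ (C.S.a - C.S.η / 4) C.S.ℓu)
    (hfy : C.S.f y ∈ Ioo (C.S.a - C.S.η / 2) (C.S.a + C.S.η / 2)) :
    C.S.D.chartMap C.S'.D y = (C.Ld hη₀ hη₀' hA hP).low y := by
  obtain ⟨hvN, hva, s, hs1, w, hw, hv⟩ := C.exists_foot_of_mem_region hy hfy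
  have hη := C.η_pos
  have hs : s ^ 2 = 1 := by rcases hs1 with rfl | rfl <;> norm_num
  symm
  have hA' : C.c + C.τ + N * η₀ - 2 * η₀ = C.S.a := by rw [hA]; ring
  refine (C.Ld hη₀ hη₀' hA hP).low_eq_of (x := y) ⟨by show C.c + C.τ + N * η₀ - 3 * η₀ < C.S.f y; linarith [hfy.1], by
    show C.S.f y < C.c + C.τ + N * η₀ + η₀; linarith [hfy.2]⟩ ?_ ?_
  · -- `g v = chartMap v`
    show g (C.S.θ (C.c + C.τ + N * η₀ - 2 * η₀ - C.S.f y, y)) = C.S.D.chartMap C.S'.D (C.S.θ (C.c + C.τ + N * η₀ - 2 * η₀ - C.S.f y, y))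
    rw [hA', hv, hfeet hs w hw hs1, HandleChart.chartMap_foot C.S'.D C.S.D hs C.T.hm C.ρ_pos C.T.hR C.hmR C.T.hball w,
      show C.m' = C.m by rw [C.m'_eq, C.m_eq]]
  · -- `chartMap` commutes with the flows
    show C.S.D.chartMap C.S'.D y = C.S'.θ (C.S.f y - (C.c + C.τ + N * η₀ - 2 * η₀),
      C.S.D.chartMap C.S'.D (C.S.θ (C.c + C.τ + N * η₀ - 2 * η₀ - C.S.f y, y)))
    rw [hA']
    exact C.chartMap_eq_flow hy hfy

/-! ### The same on the side of `M'` -/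

omit [T2Space M] [T2Space M'] in
/-- A point of the region of `M'` near the level `a'` flows inside the region to a foot of the
closed unit parameter ball. [cite: MilnorHCobordism1965, proof of Thm. 3.13 (PDF p. 18)] -/
theorem exists_foot_of_mem_region' {y : M'} (hy : y ∈ C.S'.N) (hfy : C.S'.f y ∈ Ioo (C.S'.a - C.S'.η / 2) (C.S'.a + C.S'.η / 2)) :
    C.S'.θ (C.S'.a - C.S'.f y, y) ∈ C.S'.N ∧ C.S'.f (C.S'.θ (C.S'.a - C.S'.f y, y)) = C.S'.a ∧
      ∃ s : ℝ, (s = 1 ∨ s = -1) ∧ ∃ w : 𝔼 n, ‖w‖ ≤ 1 ∧ C.S'.θ (C.S'.a - C.S'.f y, y) = C.S'.D.foot s C.m' C.ρ w := by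
  have hη := C.S'.η_pos
  have hya : C.S'.a - C.S'.η / 4 ≤ C.S'.f y := hy.2.2.2.2.1
  have hlo : C.S'.ℓ₁ < C.S'.a - C.S'.η := by
    have := C.ℓ₁'_lt; have := C.c_le; have := C.hηε; rw [C.ha, C.hη]; linarith [C.τ_pos, sq_nonneg C.S.ε]
  have hys : C.S'.f y ∈ Ioo C.Sl'.lo C.Sl'.hi := ⟨by show C.S'.ℓ₁ < _; linarith, by show _ < C.S'.a + 2 * C.S'.η; linarith [hfy.2]⟩
  have hclock : ∀ t, C.S'.f y + t ∈ Icc (C.S'.a - C.S'.η / 4) (C.S'.a + C.S'.η / 2) → C.S'.f (C.S'.θ (t, y)) = C.S'.f y + t :=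
    fun t ht => C.Sl'.apply_flow hys ⟨by show C.S'.ℓ₁ < _; linarith [ht.1], by show _ < C.S'.a + 2 * C.S'.η; linarith [ht.2]⟩
  have hva : C.S'.f (C.S'.θ (C.S'.a - C.S'.f y, y)) = C.S'.a := by
    rw [hclock _ ⟨by linarith, by linarith⟩]; ring
  have hlev : ∀ t ∈ Icc (min 0 (C.S'.a - C.S'.f y)) (max 0 (C.S'.a - C.S'.f y)),
      C.S'.f (C.S'.θ (t, y)) ∈ Icc (C.S'.a - C.S'.η / 4) C.S'.ℓu := by
    intro t ht
    have ht' : C.S'.f y + t ∈ Icc (C.S'.a - C.S'.η / 4) (C.S'.a + C.S'.η / 2) := by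
      rcases le_total 0 (C.S'.a - C.S'.f y) with h0 | h0
      · rw [min_eq_left h0, max_eq_right h0] at ht; exact ⟨by linarith [ht.1], by linarith [ht.2]⟩
      · rw [min_eq_right h0, max_eq_left h0] at ht; exact ⟨by linarith [ht.1], by linarith [ht.2, hfy.2]⟩
    rw [hclock t ht']
    exact ⟨ht'.1, by linarith [ht'.2, C.S'.a_lt_ℓu, C.S'.ha, C.S'.δ_pos]⟩
  have hvN : C.S'.θ (C.S'.a - C.S'.f y, y) ∈ C.S'.N := by
    have hiff := C.S'.mem_N_iff hlev (t := C.S'.a - C.S'.f y) (t' := 0) ⟨min_le_right _ _, le_max_right _ _⟩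
      ⟨min_le_left _ _, le_max_left _ _⟩
    rw [C.S'.isFlowOf.map_zero] at hiff
    exact hiff.2 hy
  refine ⟨hvN, hva, ?_⟩
  obtain ⟨s, hs1, w, hw, hv⟩ := C.S'.D.exists_eq_foot (s := 1) (one_pow 2) C.T'.hm C.ρ_pos C.hk' C.two_γ_le' hvN.1
    (by rw [hva, C.fp_sub_m']) (by have := hvN.2.2.2.1; rw [C.hk'] at this; exact this)
    (show ‖C.S'.D.coord (C.S'.θ (C.S'.a - C.S'.f y, y))‖ < 3 * C.S'.ε from (C.S'.N_subset_cball hvN).2)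
  exact ⟨s, hs1, w, hw, hv⟩

omit [T2Space M'] in
/-- The chart map of `M'` commutes with the flows on the region. [cite: LeeSmoothManifolds2013, Prop. 9.13] -/
theorem chartMap_eq_flow' {y : M'} (hy : y ∈ C.S'.N) (hfy : C.S'.f y ∈ Ioo (C.S'.a - C.S'.η / 2) (C.S'.a + C.S'.η / 2)) :
    C.S'.D.chartMap C.S.D y = C.S.θ (C.S'.f y - C.S'.a, C.S'.D.chartMap C.S.D (C.S'.θ (C.S'.a - C.S'.f y, y))) := by
  obtain ⟨hvN, hva, -⟩ := C.exists_foot_of_mem_region' hy hfy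
  have hη := C.S'.η_pos
  have hlo : C.S'.ℓ₁ < C.S'.a - C.S'.η := by
    have := C.ℓ₁'_lt; have := C.c_le; have := C.hηε; rw [C.ha, C.hη]; linarith [C.τ_pos, sq_nonneg C.S.ε]
  set v := C.S'.θ (C.S'.a - C.S'.f y, y) with hv
  have hvs : C.S'.f v ∈ Ioo C.Sl'.lo C.Sl'.hi := by
    rw [hva]; exact ⟨by show C.S'.ℓ₁ < _; linarith, by show _ < C.S'.a + 2 * C.S'.η; linarith⟩
  have hclock : ∀ t, C.S'.a + t ∈ Icc (C.S'.a - C.S'.η / 4) (C.S'.a + C.S'.η / 2) → C.S'.f (C.S'.θ (t, v)) = C.S'.a + t := fun t ht => by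
    rw [← hva]; exact C.Sl'.apply_flow hvs ⟨by show C.S'.ℓ₁ < C.S'.f v + t; rw [hva]; linarith [ht.1], by
      show C.S'.f v + t < C.S'.a + 2 * C.S'.η; rw [hva]; linarith [ht.2]⟩
  have hya : C.S'.a - C.S'.η / 4 ≤ C.S'.f y := hy.2.2.2.2.1
  have hmem : ∀ t ∈ Icc (min 0 (C.S'.f y - C.S'.a)) (max 0 (C.S'.f y - C.S'.a)), C.S'.θ (t, v) ∈ C.S'.D.cball (3 * C.S'.ε) := by
    intro t ht
    apply C.S'.N_subset_cball
    have hlev : ∀ t' ∈ Icc (min 0 (C.S'.f y - C.S'.a)) (max 0 (C.S'.f y - C.S'.a)),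
        C.S'.f (C.S'.θ (t', v)) ∈ Icc (C.S'.a - C.S'.η / 4) C.S'.ℓu := by
      intro t' ht'
      have ht'' : C.S'.a + t' ∈ Icc (C.S'.a - C.S'.η / 4) (C.S'.a + C.S'.η / 2) := by
        rcases le_total 0 (C.S'.f y - C.S'.a) with h0 | h0
        · rw [min_eq_left h0, max_eq_right h0] at ht'; exact ⟨by linarith [ht'.1], by linarith [ht'.2, hfy.2]⟩
        · rw [min_eq_right h0, max_eq_left h0] at ht'; exact ⟨by linarith [ht'.1], by linarith [ht'.2]⟩
      rw [hclock t' ht'']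
      exact ⟨ht''.1, by linarith [ht''.2, C.S'.a_lt_ℓu, C.S'.ha, C.S'.δ_pos]⟩
    have hiff := C.S'.mem_N_iff hlev (t := t) (t' := 0) ht ⟨min_le_left _ _, le_max_left _ _⟩
    rw [C.S'.isFlowOf.map_zero] at hiff
    exact hiff.2 hvN
  have h1inf : (1 : ℕ∞ω) ≤ ∞ := by exact_mod_cast le_top
  have h := IsFlowOf.chartMap_apply_eq C.S'.isFlowOf C.S.isFlowOf (C.S.hX.of_le h1inf) C.S'.D C.S.D
    (R := 3 * C.S'.ε) (by rw [C.hε]; exact C.S.hball) (by rw [C.hk, C.hk']) C.hr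
    (min_le_left _ _) (le_max_left _ _) hmem ⟨min_le_right _ _, le_max_right _ _⟩
  rw [C.S'.isFlowOf.map_add, show C.S'.f y - C.S'.a + (C.S'.a - C.S'.f y) = 0 by ring, C.S'.isFlowOf.map_zero] at h
  exact h

include hfeet in
omit [T2Space M'] in
/-- **The inverse lower correspondence is the chart map on the feet tubes of `M'`.**
[cite: MilnorHCobordism1965, proof of Thm. 3.13 (PDF pp. 18–19)] -/
theorem low'_eq_chartMap' {y : M'} (hy : y ∈ C.S'.D.region C.S'.ε C.S'.γ (C.S'.a - C.S'.η / 4) C.S'.ℓu)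
    (hfy : C.S'.f y ∈ Ioo (C.S'.a - C.S'.η / 2) (C.S'.a + C.S'.η / 2)) :
    C.S'.D.chartMap C.S.D y = (C.Ld hη₀ hη₀' hA hP).low' y := by
  obtain ⟨hvN, hva, s, hs1, w, hw, hv⟩ := C.exists_foot_of_mem_region' hy hfy
  have hη := C.η_pos
  have hs : s ^ 2 = 1 := by rcases hs1 with rfl | rfl <;> norm_num
  symm
  have hA' : C.c + C.τ + N * η₀ + C.σ - 2 * η₀ = C.S'.a := by rw [C.ha]; linarith [hA]
  rw [LowerData.low'_def]
  have hfy' : C.S'.f y ∈ Ioo (C.S.a + C.σ - C.S.η / 2) (C.S.a + C.σ + C.S.η / 2) := by rw [C.ha, C.hη] at hfy; exact hfy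
  refine (C.Ld hη₀ hη₀' hA hP).swap.low_eq_of (x := y) ⟨by show C.c + C.τ + N * η₀ + C.σ - 3 * η₀ < C.S'.f y; linarith [hfy'.1], by
    show C.S'.f y < C.c + C.τ + N * η₀ + C.σ + η₀; linarith [hfy'.2]⟩ ?_ ?_
  · -- `g' v' = chartMap' v'`: `v' = D'.foot s m' ρ w = g (D.foot s m ρ w)` and `g' ∘ g = id` below `A`
    show g' (C.S'.θ (C.c + C.τ + N * η₀ + C.σ - 2 * η₀ - C.S'.f y, y)) =
      C.S'.D.chartMap C.S.D (C.S'.θ (C.c + C.τ + N * η₀ + C.σ - 2 * η₀ - C.S'.f y, y))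
    rw [hA', hv, ← hfeet hs w hw hs1, hP.g'_g _ (by
        show C.S.f (C.S.D.foot s C.m C.ρ w) < _
        rw [C.T.apply_foot C.ρ_pos C.hmR hs w, C.fp_sub_m, hA]; linarith),
      hfeet hs w hw hs1, HandleChart.chartMap_foot C.S.D C.S'.D hs C.T'.hm C.ρ_pos C.T'.hR C.hmR' C.T'.hball w,
      show C.m = C.m' by rw [C.m'_eq, C.m_eq]]
  · show C.S'.D.chartMap C.S.D y = C.S.θ (C.S'.f y - (C.c + C.τ + N * η₀ + C.σ - 2 * η₀),
      C.S'.D.chartMap C.S.D (C.S'.θ (C.c + C.τ + N * η₀ + C.σ - 2 * η₀ - C.S'.f y, y)))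
    rw [hA']
    exact C.chartMap_eq_flow' hy hfy

/-! ### The handle pair -/

/-- **The handle pair of the step.** [cite: MilnorHCobordism1965, proof of Thm. 3.13 (PDF pp. 18–19)] -/
def pair : HandlePair (𝓡∂ (n + 1)) M M' where
  S := C.S
  S' := C.S'
  hk := by rw [C.hk, C.hk']
  hr := C.hr.symm
  hε := C.hε
  hγ := C.hγ
  hη := C.hη
  hδ := C.hδ
  ha := by rw [C.ha, C.hfp]; ring
  hℓ₁ := by rw [C.hℓ₁, C.hfp]; ring
  hℓ₂ := by rw [C.hℓ₂, C.hfp]; ring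
  hℓu := by rw [C.hℓu, C.hfp]; ring
  low := (C.Ld hη₀ hη₀' hA hP).low
  low' := (C.Ld hη₀ hη₀' hA hP).low'
  low_smooth := (C.Ld hη₀ hη₀' hA hP).contMDiffOn_low.mono fun x hx => by
    have hx' : C.S.f x < C.S.a + C.S.η := hx
    show C.S.f x < C.c + C.τ + N * η₀ + η₀; linarith
  low'_smooth := by
    rw [LowerData.low'_def]
    exact (C.Ld hη₀ hη₀' hA hP).swap.contMDiffOn_low.mono fun y hy => by
      have hy' : C.S'.f y < C.S'.a + C.S'.η := hy
      show C.S'.f y < C.c + C.τ + N * η₀ + C.σ + η₀; rw [C.ha, C.hη] at hy'; linarith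
  apply_low x hx := by
    have hη := C.η_pos
    have h := (C.Ld hη₀ hη₀' hA hP).apply_low (x := x)
      ⟨by show C.c + C.τ + N * η₀ - 5 * η₀ < C.S.f x; linarith [hx.1], by show C.S.f x < C.c + C.τ + N * η₀ + η₀; linarith [hx.2]⟩
    have h' : C.S'.f ((C.Ld hη₀ hη₀' hA hP).low x) = C.S.f x + (C.c + C.τ + N * η₀ + C.σ - (C.c + C.τ + N * η₀)) := h
    rw [h', C.hfp]; ring
  apply_low' y hy := by
    have hη := C.η_pos
    have hy' : C.S'.f y ∈ Ioo (C.S.a + C.σ - C.S.η / 2) (C.S.a + C.σ + C.S.η / 2) := by rw [C.ha, C.hη] at hy; exact hy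
    rw [LowerData.low'_def]
    have h := (C.Ld hη₀ hη₀' hA hP).swap.apply_low (x := y)
      ⟨by show C.c + C.τ + N * η₀ + C.σ - 5 * η₀ < C.S'.f y; linarith [hy'.1], by
        show C.S'.f y < C.c + C.τ + N * η₀ + C.σ + η₀; linarith [hy'.2]⟩
    have h' : C.S.f ((C.Ld hη₀ hη₀' hA hP).swap.low y) = C.S'.f y + (C.c + C.τ + N * η₀ - (C.c + C.τ + N * η₀ + C.σ)) := h
    rw [h', C.hfp]; ring
  low_below x hx := by
    have hη := C.η_pos
    by_cases h5 : C.S.f x ≤ C.c + C.τ + N * η₀ - 5 * η₀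
    · rw [(C.Ld hη₀ hη₀' hA hP).low_eq_g (show C.S.f x < C.c + C.τ + N * η₀ - η₀ by linarith)]
      show C.S'.f (g x) < C.S'.a - C.S'.η / 4
      have := hP.g_below x h5
      rw [C.ha, C.hη]; linarith
    · have h := (C.Ld hη₀ hη₀' hA hP).apply_low (x := x) ⟨lt_of_not_ge h5, by show C.S.f x < C.c + C.τ + N * η₀ + η₀; linarith⟩
      have h' : C.S'.f ((C.Ld hη₀ hη₀' hA hP).low x) = C.S.f x + (C.c + C.τ + N * η₀ + C.σ - (C.c + C.τ + N * η₀)) := h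
      rw [h', C.ha, C.hη]; linarith
  low'_below y hy := by
    have hη := C.η_pos
    have hy' : C.S'.f y < C.S.a + C.σ - C.S.η / 4 := by rw [C.ha, C.hη] at hy; exact hy
    rw [LowerData.low'_def]
    by_cases h5 : C.S'.f y ≤ C.c + C.τ + N * η₀ + C.σ - 5 * η₀
    · rw [(C.Ld hη₀ hη₀' hA hP).swap.low_eq_g (show C.S'.f y < C.c + C.τ + N * η₀ + C.σ - η₀ by linarith)]
      show C.S.f (g' y) < C.S.a - C.S.η / 4
      have := hP.g'_below y h5
      linarith
    · have h := (C.Ld hη₀ hη₀' hA hP).swap.apply_low (x := y) ⟨lt_of_not_ge h5, by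
        show C.S'.f y < C.c + C.τ + N * η₀ + C.σ + η₀; linarith⟩
      have h' : C.S.f ((C.Ld hη₀ hη₀' hA hP).swap.low y) = C.S'.f y + (C.c + C.τ + N * η₀ - (C.c + C.τ + N * η₀ + C.σ)) := h
      rw [h']; linarith
  low'_low x hx := (C.Ld hη₀ hη₀' hA hP).low'_low (show C.S.f x < C.c + C.τ + N * η₀ + η₀ by
    have hη := C.η_pos; have hx' : C.S.f x < C.S.a + C.S.η / 2 := hx; linarith)
  low_low' y hy := by
    have h := (C.Ld hη₀ hη₀' hA hP).swap.low'_low (x := y) (show C.S'.f y < C.c + C.τ + N * η₀ + C.σ + η₀ by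
      have hη := C.η_pos; have hy' : C.S'.f y < C.S'.a + C.S'.η / 2 := hy; rw [C.ha, C.hη] at hy'; linarith)
    rw [LowerData.low'_def]; exact h
  low_flow x t hx ht := by
    have hη := C.η_pos
    exact (C.Ld hη₀ hη₀' hA hP).low_flow
      ⟨by show C.c + C.τ + N * η₀ - 5 * η₀ < C.S.f x; linarith [hx.1], by show C.S.f x < C.c + C.τ + N * η₀ + η₀; linarith [hx.2]⟩
      ⟨by show C.c + C.τ + N * η₀ - 5 * η₀ < C.S.f x + t; linarith [ht.1], by
        show C.S.f x + t < C.c + C.τ + N * η₀ + η₀; linarith [ht.2]⟩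
  low'_flow y t hy ht := by
    have hη := C.η_pos
    have hy' : C.S'.f y ∈ Ioo (C.S.a + C.σ - C.S.η / 2) (C.S.a + C.σ + C.S.η / 2) := by rw [C.ha, C.hη] at hy; exact hy
    have ht' : C.S'.f y + t ∈ Ioo (C.S.a + C.σ - C.S.η / 2) (C.S.a + C.σ + C.S.η / 2) := by rw [C.ha, C.hη] at ht; exact ht
    rw [LowerData.low'_def]
    exact (C.Ld hη₀ hη₀' hA hP).swap.low_flow
      ⟨by show C.c + C.τ + N * η₀ + C.σ - 5 * η₀ < C.S'.f y; linarith [hy'.1], by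
        show C.S'.f y < C.c + C.τ + N * η₀ + C.σ + η₀; linarith [hy'.2]⟩
      ⟨by show C.c + C.τ + N * η₀ + C.σ - 5 * η₀ < C.S'.f y + t; linarith [ht'.1], by
        show C.S'.f y + t < C.c + C.τ + N * η₀ + C.σ + η₀; linarith [ht'.2]⟩
  hfeet y hy hfy := C.low_eq_chartMap hη₀ hη₀' hA hP hfeet hy hfy
  hfeet' y hy hfy := C.low'_eq_chartMap' hη₀ hη₀' hA hP hfeet hy hfy

/-! ### The diffeomorphism -/

omit hη₀ hη₀' hA hP hfeet in
/-- **The handle-extension step for one `1`-handle**: from a context whose `+` discs match,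
`M ≅ M'` (Milnor's Thm. 3.13 argument, via the tree's `HandlePair.exists_diffeomorph_apply_eq`).
[cite: MilnorHCobordism1965, proof of Thm. 3.13 (PDF pp. 18–19)] -/
theorem nonempty_diffeomorph [CompactSpace M] [CompactSpace M'] (hM : C.Match) :
    Nonempty (M ≃ₘ⟮𝓡∂ (n + 1), 𝓡∂ (n + 1)⟯ M') := by
  obtain ⟨g, g', η₀, N, hη₀, hη₀', hA, hP, hfeet⟩ := C.exists_extended_pair hM
  set P := C.pair hη₀ hη₀' hA hP hfeet with hPdef
  have hε := C.ε_pos; have hη := C.η_pos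
  have hσ : P.σ = C.σ := by show C.S'.f C.S'.p - C.S.f C.S.p = C.σ; rw [C.hfp]; ring
  have hregb : ∀ x, C.S.ℓu - 2 * C.S.δ ≤ P.S.f x → mfderiv (𝓡∂ (n + 1)) 𝓘(ℝ, ℝ) P.S.f x ≠ 0 := by
    intro x hx
    have hx' : C.S.ℓu - 2 * C.S.δ ≤ C.S.f x := hx
    rw [C.hℓu_eq, C.hδ_eq] at hx'
    have hxp : x ≠ C.S.p := fun h => by rw [h] at hx'; nlinarith
    exact C.hreg x (by have := C.c_le; rw [C.ha_eq] at this; nlinarith [C.τ_pos]) hxp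
  have hregb' : ∀ y, C.S.ℓu - 2 * C.S.δ + P.σ ≤ P.S'.f y → mfderiv (𝓡∂ (n + 1)) 𝓘(ℝ, ℝ) P.S'.f y ≠ 0 := by
    intro y hy
    have hy' : C.S.ℓu - 2 * C.S.δ + P.σ ≤ C.S'.f y := hy
    rw [hσ, C.hℓu_eq, C.hδ_eq] at hy'
    have hyp : y ≠ C.S'.p := fun h => by rw [h, C.hfp] at hy'; nlinarith
    exact C.hreg' y (by have := C.c_le; rw [C.ha_eq] at this; nlinarith [C.τ_pos]) hyp
  obtain ⟨Ψ, -, -, -⟩ := P.exists_diffeomorph_apply_eq C.hn1 (fun x hx => (C.hF.2.1 x hx).1) (fun x hx => C.hF.2.2 x hx)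
    (fun x hx => (C.hF'.2.1 x hx).1) (fun x hx => C.hF'.2.2 x hx) (b := C.S.ℓu - 2 * C.S.δ)
    (by show C.S.a + C.S.η ≤ C.S.ℓu - 2 * C.S.δ; rw [C.ha_eq, C.hℓu_eq, C.hδ_eq]; have := C.hηε; nlinarith)
    le_rfl (by show C.S.ℓu - 2 * C.S.δ < 1; rw [C.hℓu_eq, C.hδ_eq]; have := C.htop; nlinarith)
    (by rw [hσ]; show C.S.ℓu - 2 * C.S.δ + C.σ < 1; rw [C.hℓu_eq, C.hδ_eq]; have := C.htop'; rw [C.hfp] at this; nlinarith)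
    hregb hregb'
  exact ⟨Ψ⟩

end OneHandleStepContext

end Literature.Topology.FourManifolds
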